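import Literature.Topology.FourManifolds.OneJetTransversality
import Literature.Topology.FourManifolds.RankOneNormalForm
import Literature.Topology.FourManifolds.RegularLevelSet
import Mathlib.LinearAlgebra.Dual.Lemmas
import HarnessLib

/-!
# The critical set of a 1-jet-transverse map `ℝ⁴ → ℝ²` is a smooth curve
# (Golubitsky–Guillemin VI §1: "generically `S_r(f)` is a submanifold"; the tangent line is the
# kernel of the intrinsic derivative)

Topic `Literature/Topology/FourManifolds` (programme of the fact
`Literature.Topology.FourManifolds.exists_isSimplifiedBrokenLefschetzFibration`, Baykur–Saeki 2017, §2.1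
p. 6: for a generic map `f : X⁴ → Σ²` *"the singular locus `Z_f` of `f` […] is a disjoint union
of finitely many circles, which are composed of finitely many cusp points, and arcs and circles of
fold singularities"*).  The previous brick `OneJetTransversality.lean` makes a `C^∞` map
`g : ℝ⁴ ⊇ Ω → ℝ²` first-order generic by an arbitrarily small linear perturbation: `dg_x ≠ 0`
everywhere and `j¹g ⋔ S₁` at every critical point, in the covector reading
`OneJet.IsOneJetTransverseAt`.  This file draws the printed consequence at ONE such critical
point `x₀` (Golubitsky–Guillemin, *Stable Mappings and Their Singularities* (1973), Ch. VI §1,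
p. 143: *"generically `S_r(f)` is a submanifold of `X` and codim `S_r(f) = codim S_r = r² + er`
[…] This statement follows immediately from the Thom Transversality Theorem and II,
Theorem 4.4"* — here `r = 1`, `e = 2`, codim `3` in `ℝ⁴`; and Ch. VI §3, Lemma 3.2 /
Prop. 3.7: the tangent space of `S_r(f)` is the kernel of the intrinsic derivative):

* `OneJet.IsOneJetTransverseAt.surjective_incidence` / `isOneJetTransverseAt_iff_surjective_incidence`
  — the covector reading is EQUIVALENT (finite dimension, any `E`, `F`) to the surjectivity of
  the incidence derivative `(v, λ) ↦ ℓ ∘ D²g(x)(v, ·) + λ ∘ dg_x : E × F* → E*` for every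
  non-zero `ℓ` killing `Im dg_x` (the converse of `OneJet.eq_zero_of_surjective_incidence`, by
  duality: a proper subspace of `E*` has a common zero `k ≠ 0`);
* the linear algebra of a rank-one `2 × 4` matrix `M = dg_{x₀}` (`exists_ne_zero_comp_eq_zero`:
  a cokernel covector `ℓ₀`; `exists_eq_smul_of_not_surjective`: `Im M` is the line through any
  non-zero `M e`; `exists_eq_smul_of_apply_eq_zero`: `Ker ℓ₀` is that line);
* **`OneJet.exists_criticalChart`** — at a critical point `x₀ ∈ Ω` of rank one
  (`dg_{x₀} ≠ 0`, not onto) where `g` is 1-jet-transverse there is a local diffeomorphism `φ` of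
  `ℝ⁴` (`C^∞` with `C^∞` inverse, `φ x₀ = 0`, source inside `Ω`) **straightening the critical
  set: for `q` in the source, `dg_q` is not onto iff `(φ q)₁ = (φ q)₂ = (φ q)₃ = 0`** — so the
  critical set is, near `x₀`, a `C^∞` embedded curve (the same coordinate description as in the
  tree's fold charts, `surjective_mfderiv_iff_of_foldChart`) — **and its differential at `x₀`
  carries the line `T = {v | ℓ(D²g(x₀)(v, k)) = 0 for all k ∈ Ker dg_{x₀}}`** (the kernel of the
  intrinsic derivative, for any cokernel covector `ℓ`) **onto the first coordinate axis**: `T` is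
  the tangent line of the critical curve (GG VI, Lemma 3.2).

Proof of the chart (GG's Grassmannian/incidence description of `S₁`, VI (1.2), read on the
cokernel line, then II Thm. 2.4 = the implicit function theorem): with `e` a basis vector such
that `m = dg_{x₀} e ≠ 0`, `ℓ₀ ≠ 0` killing `Im dg_{x₀}` and `ℓ'(m) = 1`, put
`H(q) = ℓ'(dg_q e) · ℓ₀ ∘ dg_q - ℓ₀(dg_q e) · ℓ' ∘ dg_q ∈ (ℝ⁴)*` (the cokernel covector of `dg_q`,
normalised against `dg_q e`, applied to `dg_q`; polynomial in the 1-jet, `H(q) e = 0`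
identically).  Where `dg_q e ≠ 0`: `dg_q` is not onto iff `Im dg_q = ℝ · dg_q e` iff `H(q) = 0`.
At `x₀`, `DH(v) = ℓ₀ ∘ D²g(x₀)(v, ·) - ℓ₀(D²g(x₀)(v, e)) · ℓ' ∘ dg_{x₀}` maps ONTO the
annihilator of `e` by the surjective incidence form of transversality, so `Ker DH` is a line
`ℝ t₀` (rank–nullity), which is `T`; with `α(t₀) = 1` the map
`φ(q) = (α(q - x₀), H(q) w₁, H(q) w₂, H(q) w₃)` (`w₁, w₂, w₃` the other three basis vectors) has
invertible differential at `x₀` and is the chart.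

Everything here is proved; no definitions, no named facts (D-0026).  Not here: the fold/cusp
dichotomy along the curve and the second-order genericity of the cusp candidates (next bricks).

## References

* M. Golubitsky, V. Guillemin, *Stable Mappings and Their Singularities*, GTM 14 (1973): Ch. II
  §2, Thm. 2.4 (preimage of a transversal submanifold); Ch. VI §1, p. 143, Prop. 1.1, (1.2),
  Def. 1.5; Ch. VI §3, (3.1), Lemma 3.2, Prop. 3.7. [GolubitskyGuillemin1973]
* R. İ. Baykur, O. Saeki, *Simplifying indefinite fibrations on 4-manifolds*, arXiv:1705.11169,
  §2.1, p. 6. [BaykurSaeki2017]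
-/

noncomputable section

open Set Function Filter Module
open scoped ContDiff Topology

namespace Literature.Topology.FourManifolds

namespace OneJet

/-! ### The covector reading of transversality is the surjectivity of the incidence derivative -/

section Incidence

variable {E F : Type} [NormedAddCommGroup E] [NormedSpace ℝ E] [FiniteDimensional ℝ E]
  [NormedAddCommGroup F] [NormedSpace ℝ F]

/-- Every linear functional on the (continuous) dual of a finite-dimensional space is evaluation
at a vector (reflexivity, `Module.evalEquiv`). [folklore] -/
theorem exists_forall_dual_apply_eq (Λ : (E →L[ℝ] ℝ) →ₗ[ℝ] ℝ) :
    ∃ k : E, ∀ φ : E →L[ℝ] ℝ, Λ φ = φ k := by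
  set Λ' : Module.Dual ℝ (Module.Dual ℝ E) :=
    Λ ∘ₗ (LinearMap.toContinuousLinearMap : (E →ₗ[ℝ] ℝ) ≃ₗ[ℝ] E →L[ℝ] ℝ).toLinearMap with hΛ'
  refine ⟨(Module.evalEquiv ℝ E).symm Λ', fun φ => ?_⟩
  have h := Module.apply_evalEquiv_symm_apply ℝ E (φ : E →ₗ[ℝ] ℝ) Λ'
  have hφ : LinearMap.toContinuousLinearMap (φ : E →ₗ[ℝ] ℝ) = φ := by
    ext v
    simp
  rw [ContinuousLinearMap.coe_coe] at h
  rw [h, hΛ', LinearMap.comp_apply]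
  simp [hφ]

omit [FiniteDimensional ℝ E] in
/-- The incidence derivative `(v, λ) ↦ ℓ ∘ D²g(x)(v, ·) + λ ∘ dg_x`, as a linear map. [folklore] -/
theorem incidence_isLinear (g : E → F) (x : E) (ℓ : F →L[ℝ] ℝ) :
    IsLinearMap ℝ fun vl : E × (F →L[ℝ] ℝ) =>
      ℓ.comp (fderiv ℝ (fderiv ℝ g) x vl.1) + vl.2.comp (fderiv ℝ g x) := by
  constructor
  · intro a b
    simp only [Prod.fst_add, Prod.snd_add, map_add, ContinuousLinearMap.comp_add,
      ContinuousLinearMap.add_comp]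
    abel
  · intro c a
    simp only [Prod.smul_fst, Prod.smul_snd, map_smul, ContinuousLinearMap.comp_smul,
      ContinuousLinearMap.smul_comp, smul_add]

/-- **Transversality in the covector reading implies the surjectivity of the incidence
derivative** (converse of `OneJet.eq_zero_of_surjective_incidence`): if the range of
`(v, λ) ↦ ℓ ∘ D²g(x)(v, ·) + λ ∘ dg_x` were a proper subspace of `E*`, a non-zero functional on
`E*` — evaluation at some `k ≠ 0` — would kill it; `λ := anything` gives `dg_x k = 0` and
`λ := 0` gives `ℓ(D²g(x)(v, k)) = 0` for all `v`, so transversality forces `k = 0`.  This is the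
equivalence (a) ⇔ (b) of Golubitsky–Guillemin VI Prop. 3.7 read on the cokernel line `ℝ ℓ`.
[cite: GolubitskyGuillemin1973, Ch. VI §3, Lemma 3.2 and Prop. 3.7] -/
theorem IsOneJetTransverseAt.surjective_incidence {g : E → F} {x : E}
    (h : IsOneJetTransverseAt g x) {ℓ : F →L[ℝ] ℝ} (hℓ : ℓ ≠ 0)
    (hcomp : ℓ.comp (fderiv ℝ g x) = 0) :
    Surjective fun vl : E × (F →L[ℝ] ℝ) =>
      ℓ.comp (fderiv ℝ (fderiv ℝ g) x vl.1) + vl.2.comp (fderiv ℝ g x) := by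
  set T₀ : (E × (F →L[ℝ] ℝ)) →ₗ[ℝ] (E →L[ℝ] ℝ) := (incidence_isLinear g x ℓ).mk' _ with hT₀
  suffices hT : Surjective T₀ by
    intro ψ
    obtain ⟨a, ha⟩ := hT ψ
    exact ⟨a, ha⟩
  by_contra hns
  have hlt : LinearMap.range T₀ < ⊤ :=
    lt_top_iff_ne_top.2 fun htop => hns (LinearMap.range_eq_top.1 htop)
  obtain ⟨Λ, hΛ0, hΛ⟩ := Submodule.exists_dual_map_eq_bot_of_lt_top hlt inferInstance
  obtain ⟨k, hk⟩ := exists_forall_dual_apply_eq Λ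
  have hvan : ∀ vl, Λ (T₀ vl) = 0 := fun vl => by
    have hmem : Λ (T₀ vl) ∈ (LinearMap.range T₀).map Λ :=
      Submodule.mem_map_of_mem (LinearMap.mem_range_self T₀ vl)
    rw [hΛ] at hmem
    simpa using hmem
  have hT₀apply : ∀ (v : E) (lam : F →L[ℝ] ℝ),
      T₀ (v, lam) = ℓ.comp (fderiv ℝ (fderiv ℝ g) x v) + lam.comp (fderiv ℝ g x) := fun v lam => rfl
  -- `dg_x k = 0`
  have hMk : fderiv ℝ g x k = 0 := by
    by_contra hne
    obtain ⟨lam, -, hlam⟩ := exists_dual_vector ℝ (fderiv ℝ g x k) (norm_ne_zero_iff.2 hne)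
    have h0 := hvan (0, lam)
    rw [hk, hT₀apply] at h0
    simp only [map_zero, ContinuousLinearMap.comp_zero, zero_add,
      ContinuousLinearMap.comp_apply] at h0
    have h1 : (lam (fderiv ℝ g x k) : ℝ) = ‖fderiv ℝ g x k‖ := by simpa using hlam
    exact hne (norm_eq_zero.1 (h1 ▸ h0))
  -- `ℓ(D²g(x)(v, k)) = 0` for all `v`
  have hv : ∀ v : E, ℓ (fderiv ℝ (fderiv ℝ g) x v k) = 0 := fun v => by
    have h0 := hvan (v, 0)
    rw [hk, hT₀apply] at h0
    simpa using h0
  have hk0 : k = 0 := h ℓ hℓ hcomp k hMk hv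
  apply hΛ0
  ext φ
  rw [hk, hk0, map_zero, LinearMap.zero_apply]

/-- **The covector reading of `j¹g ⋔ S` is equivalent to the surjectivity of the incidence
derivative** for every non-zero covector killing the image (Golubitsky–Guillemin VI Prop. 3.7
(a) ⇔ (b), on each line of the cokernel).
[cite: GolubitskyGuillemin1973, Ch. VI §3, Prop. 3.7] -/
theorem isOneJetTransverseAt_iff_surjective_incidence (g : E → F) (x : E) :
    IsOneJetTransverseAt g x ↔ ∀ ℓ : F →L[ℝ] ℝ, ℓ ≠ 0 → ℓ.comp (fderiv ℝ g x) = 0 →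
      Surjective fun vl : E × (F →L[ℝ] ℝ) =>
        ℓ.comp (fderiv ℝ (fderiv ℝ g) x vl.1) + vl.2.comp (fderiv ℝ g x) :=
  ⟨fun h _ hℓ hcomp => h.surjective_incidence hℓ hcomp,
    fun h ℓ hℓ hcomp _ hk hv => eq_zero_of_surjective_incidence (h ℓ hℓ hcomp) hk hv⟩

end Incidence

/-! ### Linear algebra of a rank-one `2 × 4` matrix -/

section RankOne

/-- Local notation for this file: the model space `ℝⁿ = EuclideanSpace ℝ (Fin n)`. -/
local notation "𝔼 " n:arg => EuclideanSpace ℝ (Fin n)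

variable {E : Type} [NormedAddCommGroup E] [NormedSpace ℝ E]

/-- A non-zero vector of a real normed space is sent to `1` by some covector (Hahn–Banach).
[folklore] -/
theorem exists_covector_apply_eq_one {m : E} (hm : m ≠ 0) : ∃ ℓ : E →L[ℝ] ℝ, ℓ m = 1 := by
  obtain ⟨ℓ, -, hℓ⟩ := exists_dual_vector ℝ m (norm_ne_zero_iff.2 hm)
  have h1 : (ℓ m : ℝ) = ‖m‖ := by simpa using hℓ
  refine ⟨‖m‖⁻¹ • ℓ, ?_⟩
  rw [_root_.smul_apply, h1, smul_eq_mul, inv_mul_cancel₀ (norm_ne_zero_iff.2 hm)]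

/-- A linear map to the plane which is not onto has a non-zero cokernel covector:
`ℓ₀ ≠ 0` with `ℓ₀ ∘ M = 0`. [folklore] -/
theorem exists_ne_zero_comp_eq_zero {M : E →L[ℝ] 𝔼 2} (hM : ¬ Surjective M) :
    ∃ ℓ₀ : (𝔼 2) →L[ℝ] ℝ, ℓ₀ ≠ 0 ∧ ℓ₀.comp M = 0 := by
  have hlt : LinearMap.range (M : E →ₗ[ℝ] 𝔼 2) < ⊤ :=
    lt_top_iff_ne_top.2 fun htop => hM (LinearMap.range_eq_top.1 htop)
  obtain ⟨f, hf0, hf⟩ := Submodule.exists_dual_map_eq_bot_of_lt_top hlt inferInstance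
  refine ⟨LinearMap.toContinuousLinearMap f, ?_, ?_⟩
  · intro h
    apply hf0
    ext u
    have := congrArg (fun φ : (𝔼 2) →L[ℝ] ℝ => φ u) h
    simpa using this
  · ext v
    have hmem : f (M v) ∈ (LinearMap.range (M : E →ₗ[ℝ] 𝔼 2)).map f :=
      Submodule.mem_map_of_mem (LinearMap.mem_range_self (M : E →ₗ[ℝ] 𝔼 2) v)
    rw [hf] at hmem
    simpa using hmem

/-- **The image of a non-onto linear map to the plane is the line through any non-zero value**:
`M v = a · M e` for some `a`. [folklore] -/
theorem exists_eq_smul_of_not_surjective {M : E →L[ℝ] 𝔼 2} (hM : ¬ Surjective M) {e : E}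
    (he : M e ≠ 0) (v : E) : ∃ a : ℝ, M v = a • M e := by
  set R : Submodule ℝ (𝔼 2) := LinearMap.range (M : E →ₗ[ℝ] 𝔼 2) with hR
  have hne : R ≠ ⊤ := fun htop => hM (LinearMap.range_eq_top.1 htop)
  have hlt : finrank ℝ R < 2 := by
    have := Submodule.finrank_lt hne
    rwa [finrank_euclideanSpace_fin] at this
  have hme : M e ∈ R := LinearMap.mem_range_self (M : E →ₗ[ℝ] 𝔼 2) e
  have hm0 : (⟨M e, hme⟩ : R) ≠ 0 := fun h => he (by simpa using congrArg Subtype.val h)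
  have hpos : 0 < finrank ℝ R := Module.finrank_pos_iff_exists_ne_zero.2 ⟨_, hm0⟩
  have h1 : finrank ℝ R = 1 := by omega
  obtain ⟨c, hc⟩ := (finrank_eq_one_iff_of_nonzero' _ hm0).1 h1
    ⟨M v, LinearMap.mem_range_self (M : E →ₗ[ℝ] 𝔼 2) v⟩
  exact ⟨c, by simpa using congrArg Subtype.val hc.symm⟩

/-- **The kernel of a non-zero covector of the plane is the line through any of its non-zero
vectors**: `ℓ₀ ≠ 0`, `ℓ₀ m = 0`, `m ≠ 0`, `ℓ₀ u = 0` give `u = c · m`. [folklore] -/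
theorem exists_eq_smul_of_apply_eq_zero {ℓ₀ : (𝔼 2) →L[ℝ] ℝ} (hℓ₀ : ℓ₀ ≠ 0) {m : 𝔼 2}
    (h0 : ℓ₀ m = 0) (hm : m ≠ 0) {u : 𝔼 2} (hu : ℓ₀ u = 0) : ∃ c : ℝ, u = c • m := by
  set K : Submodule ℝ (𝔼 2) := LinearMap.ker (ℓ₀ : (𝔼 2) →ₗ[ℝ] ℝ) with hK
  obtain ⟨u₁, hu₁⟩ := exists_apply_eq_one hℓ₀
  have hrange : LinearMap.range (ℓ₀ : (𝔼 2) →ₗ[ℝ] ℝ) = ⊤ :=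
    LinearMap.range_eq_top.2 fun r => ⟨r • u₁, by simp [hu₁]⟩
  have hsum := LinearMap.finrank_range_add_finrank_ker (ℓ₀ : (𝔼 2) →ₗ[ℝ] ℝ)
  rw [hrange, finrank_top, Module.finrank_self, finrank_euclideanSpace_fin] at hsum
  have h1 : finrank ℝ K = 1 := by rw [hK]; omega
  have hmK : m ∈ K := by simpa [hK] using h0
  have hm0 : (⟨m, hmK⟩ : K) ≠ 0 := fun h => hm (by simpa using congrArg Subtype.val h)
  have huK : u ∈ K := by simpa [hK] using hu
  obtain ⟨c, hc⟩ := (finrank_eq_one_iff_of_nonzero' _ hm0).1 h1 ⟨u, huK⟩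
  exact ⟨c, by simpa using congrArg Subtype.val hc.symm⟩

/-- Two covectors of the plane, `ℓ₀ ≠ 0` with `ℓ₀ m = 0` and `ℓ'` with `ℓ' m = 1`, have no common
zero but `0`. [folklore] -/
theorem eq_zero_of_apply_eq_zero₂ {ℓ₀ ℓ' : (𝔼 2) →L[ℝ] ℝ} (hℓ₀ : ℓ₀ ≠ 0) {m : 𝔼 2}
    (h0 : ℓ₀ m = 0) (h1 : ℓ' m = 1) {u : 𝔼 2} (hu0 : ℓ₀ u = 0) (hu1 : ℓ' u = 0) : u = 0 := by
  have hm : m ≠ 0 := by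
    rintro rfl
    simp at h1
  obtain ⟨c, rfl⟩ := exists_eq_smul_of_apply_eq_zero hℓ₀ h0 hm hu0
  have : c = 0 := by simpa [h1] using hu1
  simp [this]

/-- A covector of the plane vanishing at `m ≠ 0` is a multiple of any non-zero covector vanishing
at `m` (the cokernel covector of a rank-one map is unique up to scale). [folklore] -/
theorem exists_eq_smul_covector {ℓ₀ ℓ : (𝔼 2) →L[ℝ] ℝ} (hℓ₀ : ℓ₀ ≠ 0) {m : 𝔼 2}
    (h0 : ℓ₀ m = 0) (hm : m ≠ 0) (hℓ : ℓ m = 0) : ∃ a : ℝ, ℓ = a • ℓ₀ := by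
  obtain ⟨u₁, hu₁⟩ := exists_apply_eq_one hℓ₀
  refine ⟨ℓ u₁, ?_⟩
  ext u
  -- `u = ℓ₀(u) u₁ + r` with `ℓ₀ r = 0`, so `r = c m` and `ℓ r = 0`
  have hr : ℓ₀ (u - ℓ₀ u • u₁) = 0 := by simp [hu₁]
  obtain ⟨c, hc⟩ := exists_eq_smul_of_apply_eq_zero hℓ₀ h0 hm hr
  have hu : u = ℓ₀ u • u₁ + c • m := by rw [← hc]; abel
  conv_lhs => rw [hu]
  simp [hℓ, mul_comm]

/-- For a non-onto `M` with `ℓ'(M e) = 1`: every covector `λ` factors on the image as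
`λ ∘ M = λ(M e) · ℓ' ∘ M`. [folklore] -/
theorem comp_eq_smul_comp {M : E →L[ℝ] 𝔼 2} (hM : ¬ Surjective M) {e : E} {ℓ' : (𝔼 2) →L[ℝ] ℝ}
    (h1 : ℓ' (M e) = 1) (lam : (𝔼 2) →L[ℝ] ℝ) : lam.comp M = lam (M e) • ℓ'.comp M := by
  have he : M e ≠ 0 := by
    intro h
    rw [h, map_zero] at h1
    exact zero_ne_one h1
  ext v
  obtain ⟨a, ha⟩ := exists_eq_smul_of_not_surjective hM he v
  simp [ha, h1, mul_comm]

/-- A linear map `ℝ⁴ → ℝ²` vanishing on the standard basis vanishes. [folklore] -/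
theorem clm_eq_zero_of_forall_apply_single_eq_zero {M : 𝔼 4 →L[ℝ] 𝔼 2}
    (h : ∀ j : Fin 4, M (EuclideanSpace.single j (1 : ℝ)) = 0) : M = 0 := by
  ext v i
  have hv : v = ∑ j : Fin 4, v j • EuclideanSpace.single j (1 : ℝ) := by
    conv_lhs => rw [← (EuclideanSpace.basisFun (Fin 4) ℝ).sum_repr v]
    simp
  rw [hv, map_sum]
  simp [h]

/-- A covector of `ℝ⁴` vanishing on `e_j` and on the three other basis vectors
`e_{j.succAbove i}` vanishes. [folklore] -/
theorem eq_zero_of_apply_single_succAbove (j : Fin 4) {ψ : 𝔼 4 →L[ℝ] ℝ}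
    (hj : ψ (EuclideanSpace.single j (1 : ℝ)) = 0)
    (hw : ∀ i : Fin 3, ψ (EuclideanSpace.single (j.succAbove i) (1 : ℝ)) = 0) : ψ = 0 :=
  eq_zero_of_forall_apply_single_eq_zero fun k => by
    rcases Fin.eq_self_or_eq_succAbove j k with rfl | ⟨i, rfl⟩
    · exact hj
    · exact hw i

end RankOne

/-! ### Three pieces of linear algebra used by the chart -/

section Pieces

/-- Local notation for this file: the model space `ℝⁿ = EuclideanSpace ℝ (Fin n)`. -/
local notation "𝔼 " n:arg => EuclideanSpace ℝ (Fin n)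

variable {E : Type} [NormedAddCommGroup E] [NormedSpace ℝ E]

/-- **Criticality read on the normalised cokernel covector.**  With `ℓ₀ ≠ 0`, `ℓ₀ m = 0`,
`ℓ' m = 1`: a linear map `M_q` to the plane with `M_q e ≠ 0` is NOT onto iff the covector
`ℓ'(M_q e) ℓ₀ - ℓ₀(M_q e) ℓ'` (which kills `M_q e` and is non-zero) kills the whole image.
[folklore] -/
theorem not_surjective_iff_smul_comp_sub_eq_zero {ℓ₀ ℓ' : (𝔼 2) →L[ℝ] ℝ} (hℓ₀ : ℓ₀ ≠ 0)
    {m : 𝔼 2} (hℓ₀m : ℓ₀ m = 0) (hℓ'm : ℓ' m = 1) {Mq : E →L[ℝ] 𝔼 2} {e : E} (hq : Mq e ≠ 0) :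
    ¬ Surjective Mq ↔ ℓ' (Mq e) • ℓ₀.comp Mq - ℓ₀ (Mq e) • ℓ'.comp Mq = 0 := by
  constructor
  · intro hns
    ext u
    obtain ⟨a, ha⟩ := exists_eq_smul_of_not_surjective hns hq u
    simp only [_root_.sub_apply, _root_.smul_apply, ContinuousLinearMap.comp_apply, ha, map_smul,
      smul_eq_mul, _root_.zero_apply]
    ring
  · intro hH0 hsurj
    -- the covector `ℓ_q = ℓ'(M_q e) ℓ₀ - ℓ₀(M_q e) ℓ'` kills `Im M_q`, hence vanishes
    have hℓq : (ℓ' (Mq e) • ℓ₀ - ℓ₀ (Mq e) • ℓ').comp Mq = 0 := by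
      rw [← hH0]
      ext u
      simp
    have hℓq0 : ℓ' (Mq e) • ℓ₀ - ℓ₀ (Mq e) • ℓ' = 0 := by
      ext y
      obtain ⟨u, rfl⟩ := hsurj y
      simpa using congrArg (fun χ : E →L[ℝ] ℝ => χ u) hℓq
    have hN0 : ℓ₀ (Mq e) = 0 := by
      have h := congrArg (fun χ : (𝔼 2) →L[ℝ] ℝ => χ m) hℓq0
      simp only [_root_.sub_apply, _root_.smul_apply, hℓ₀m, hℓ'm, smul_eq_mul, mul_zero,
        mul_one, zero_sub, _root_.zero_apply, neg_eq_zero] at h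
      exact h
    have hD0 : ℓ' (Mq e) = 0 := by
      rw [hN0, zero_smul, sub_zero] at hℓq0
      by_contra hD
      apply hℓ₀
      have h := congrArg (fun χ : (𝔼 2) →L[ℝ] ℝ => (ℓ' (Mq e))⁻¹ • χ) hℓq0
      simpa [hD] using h
    exact hq (eq_zero_of_apply_eq_zero₂ hℓ₀ hℓ₀m hℓ'm hN0 hD0)

/-- **The kernel of the intrinsic derivative, read on `S`.**  For `M` not onto with
`ℓ'(M e) = 1` and any linear `D` (a slice `D²g(x₀)(v, ·)` of the 2-jet):
`ℓ₀(D k) = 0` for all `k ∈ Ker M` iff `ℓ₀ ∘ D - ℓ₀(D e) · ℓ' ∘ M = 0` (decompose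
`u = k + b e` along `Ker M ⊕ ℝ e`). [cite: GolubitskyGuillemin1973, Ch. VI §3, Lemma 3.2] -/
theorem forall_ker_iff_comp_sub_smul_eq_zero {M D : E →L[ℝ] 𝔼 2} (hM : ¬ Surjective M) {e : E}
    (he : M e ≠ 0) {ℓ₀ ℓ' : (𝔼 2) →L[ℝ] ℝ} (hℓ'm : ℓ' (M e) = 1) :
    (∀ k, M k = 0 → ℓ₀ (D k) = 0) ↔ ℓ₀.comp D - ℓ₀ (D e) • ℓ'.comp M = 0 := by
  constructor
  · intro h
    ext u
    obtain ⟨b, hb⟩ := exists_eq_smul_of_not_surjective hM he u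
    have hk : M (u - b • e) = 0 := by rw [map_sub, map_smul, hb, sub_self]
    have h1 : ℓ₀ (D u) = b * ℓ₀ (D e) := by
      have h2 := h _ hk
      rw [map_sub, map_smul, map_sub, map_smul, smul_eq_mul] at h2
      linarith
    simp only [_root_.sub_apply, _root_.smul_apply, ContinuousLinearMap.comp_apply, hb, map_smul,
      hℓ'm, smul_eq_mul, mul_one, _root_.zero_apply, h1]
    ring
  · intro h k hk
    have := congrArg (fun ψ : E →L[ℝ] ℝ => ψ k) h
    simp only [_root_.sub_apply, _root_.smul_apply, ContinuousLinearMap.comp_apply, hk, map_zero,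
      smul_eq_mul, mul_zero, sub_zero, _root_.zero_apply] at this
    exact this

/-- **Rank–nullity for the differential of `H`.**  A linear `S : ℝ⁴ → (ℝ⁴)*` whose values kill
`e ≠ 0` and which reaches every covector killing `e` has a one-dimensional kernel `ℝ t₀`
(`dim (ℝ⁴)* = 4`, the annihilator of `e` has dimension `3`). [folklore] -/
theorem exists_ker_eq_line {S : 𝔼 4 →L[ℝ] (𝔼 4 →L[ℝ] ℝ)} {e : 𝔼 4} (he : e ≠ 0)
    (hSe : ∀ v, S v e = 0) (hSonto : ∀ ψ : 𝔼 4 →L[ℝ] ℝ, ψ e = 0 → ∃ v, S v = ψ) :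
    ∃ t₀ : 𝔼 4, t₀ ≠ 0 ∧ S t₀ = 0 ∧ ∀ v, S v = 0 → ∃ c : ℝ, v = c • t₀ := by
  set Sₗ : 𝔼 4 →ₗ[ℝ] (𝔼 4 →L[ℝ] ℝ) := (S : 𝔼 4 →ₗ[ℝ] (𝔼 4 →L[ℝ] ℝ)) with hSₗ
  set evE : (𝔼 4 →L[ℝ] ℝ) →ₗ[ℝ] ℝ :=
    ((ContinuousLinearMap.apply ℝ ℝ e : (𝔼 4 →L[ℝ] ℝ) →L[ℝ] ℝ) : (𝔼 4 →L[ℝ] ℝ) →ₗ[ℝ] ℝ)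
    with hevE
  have hevE_apply : ∀ ψ : 𝔼 4 →L[ℝ] ℝ, evE ψ = ψ e := fun ψ => rfl
  have hrange : LinearMap.range Sₗ = LinearMap.ker evE := by
    apply le_antisymm
    · rintro ψ ⟨v, rfl⟩
      rw [LinearMap.mem_ker, hevE_apply]
      exact hSe v
    · intro ψ hψ
      rw [LinearMap.mem_ker, hevE_apply] at hψ
      obtain ⟨v, hv⟩ := hSonto ψ hψ
      exact ⟨v, hv⟩
  obtain ⟨α₀, hα₀⟩ := exists_covector_apply_eq_one he
  have hevE_range : LinearMap.range evE = ⊤ :=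
    LinearMap.range_eq_top.2 fun r => ⟨r • α₀, by rw [map_smul, hevE_apply, hα₀, smul_eq_mul, mul_one]⟩
  have hdual : finrank ℝ (𝔼 4 →L[ℝ] ℝ) = 4 := by
    rw [finrank_continuousLinearMap_real, finrank_euclideanSpace_fin, Module.finrank_self]
  have hkerE : finrank ℝ (LinearMap.ker evE) = 3 := by
    have hsum := LinearMap.finrank_range_add_finrank_ker evE
    rw [hevE_range, finrank_top, Module.finrank_self, hdual] at hsum
    omega
  have hkerS : finrank ℝ (LinearMap.ker Sₗ) = 1 := by
    have hsum := LinearMap.finrank_range_add_finrank_ker Sₗ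
    rw [hrange, hkerE, finrank_euclideanSpace_fin] at hsum
    omega
  obtain ⟨t, ht0, ht⟩ := finrank_eq_one_iff'.1 hkerS
  refine ⟨(t : 𝔼 4), fun h => ht0 (Subtype.ext h), ?_, fun v hv => ?_⟩
  · have h := LinearMap.mem_ker.1 t.2
    exact h
  · have hvK : v ∈ LinearMap.ker Sₗ := by simpa [hSₗ] using hv
    obtain ⟨c, hc⟩ := ht ⟨v, hvK⟩
    exact ⟨c, by simpa using congrArg Subtype.val hc.symm⟩

end Pieces

/-! ### The critical set near a transverse rank-one point is a smooth curve -/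

section Chart

/-- Local notation for this file: the model space `ℝⁿ = EuclideanSpace ℝ (Fin n)`. -/
local notation "𝔼 " n:arg => EuclideanSpace ℝ (Fin n)

set_option maxHeartbeats 400000 in
-- the chart assembly is one long elaboration (many `set`s of operator-valued maps)
/-- **The critical set of a 1-jet-transverse map `ℝ⁴ → ℝ²` is a smooth curve near a rank-one
critical point, with tangent line the kernel of the intrinsic derivative** (Golubitsky–Guillemin
1973, Ch. VI §1, p. 143: *"generically `S_r(f)` is a submanifold of `X` and
codim `S_r(f) = codim S_r`"*, `= 3` for `S₁` of maps `ℝ⁴ → ℝ²`, via II Thm. 2.4; Ch. VI §3,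
Lemma 3.2 with Prop. 3.7: `T_x S₁(f)` is the kernel of the intrinsic derivative; Baykur–Saeki
§2.1 p. 6: the singular locus of a generic map is a 1-dimensional submanifold).  Let
`g : ℝ⁴ ⊇ Ω → ℝ²` be `C^∞` on the open set `Ω`, `x₀ ∈ Ω` a critical point (`dg_{x₀}` not onto)
of rank one (`dg_{x₀} ≠ 0`) at which `g` is 1-jet-transverse.  Then there is a local
diffeomorphism `φ` of `ℝ⁴` at `x₀` — `C^∞` with `C^∞` inverse on its source `⊆ Ω`, `φ x₀ = 0` —
such that (i) for every `q` in the source, **`dg_q` is not onto iff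
`(φ q)₁ = (φ q)₂ = (φ q)₃ = 0`**, and (ii) for every non-zero covector `ℓ` of `ℝ²` killing
`Im dg_{x₀}` and every `v ∈ ℝ⁴`: **`ℓ(D²g(x₀)(v, k)) = 0` for all `k ∈ Ker dg_{x₀}` iff
`(dφ_{x₀} v)₁ = (dφ_{x₀} v)₂ = (dφ_{x₀} v)₃ = 0`** — the differential of the chart carries the
kernel of the intrinsic derivative onto the axis of the straightened curve.
[cite: GolubitskyGuillemin1973, Ch. VI §1, p. 143 and Def. 1.5; Ch. VI §3, Lemma 3.2, Prop. 3.7; Ch. II §2, Thm. 2.4]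
[cite: BaykurSaeki2017, §2.1, p. 6] -/
theorem exists_criticalChart {g : 𝔼 4 → 𝔼 2} {Ω : Set (𝔼 4)} (hΩ : IsOpen Ω)
    (hg : ContDiffOn ℝ ∞ g Ω) {x₀ : 𝔼 4} (hx₀ : x₀ ∈ Ω) (hcrit : ¬ Surjective (fderiv ℝ g x₀))
    (hne : fderiv ℝ g x₀ ≠ 0) (htr : IsOneJetTransverseAt g x₀) :
    ∃ φ : OpenPartialHomeomorph (𝔼 4) (𝔼 4), x₀ ∈ φ.source ∧ φ x₀ = 0 ∧ φ.source ⊆ Ω ∧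
      ContDiffOn ℝ ∞ φ φ.source ∧ ContDiffOn ℝ ∞ φ.symm φ.target ∧
      (∀ q ∈ φ.source, (¬ Surjective (fderiv ℝ g q) ↔ ∀ i : Fin 3, φ q i.succ = 0)) ∧
      (∀ ℓ : (𝔼 2) →L[ℝ] ℝ, ℓ ≠ 0 → ℓ.comp (fderiv ℝ g x₀) = 0 → ∀ v : 𝔼 4,
        ((∀ k, fderiv ℝ g x₀ k = 0 → ℓ (fderiv ℝ (fderiv ℝ g) x₀ v k) = 0) ↔
          ∀ i : Fin 3, fderiv ℝ φ x₀ v i.succ = 0)) := by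
  /- smoothness data -/
  set M : 𝔼 4 →L[ℝ] 𝔼 2 := fderiv ℝ g x₀ with hM
  set D2 : 𝔼 4 →L[ℝ] 𝔼 4 →L[ℝ] 𝔼 2 := fderiv ℝ (fderiv ℝ g) x₀ with hD2
  have hdg : ContDiffOn ℝ ∞ (fderiv ℝ g) Ω := hg.fderiv_of_isOpen hΩ (by simp)
  have hD2d : HasFDerivAt (fderiv ℝ g) D2 x₀ :=
    ((hdg.contDiffAt (hΩ.mem_nhds hx₀)).differentiableAt (by simp)).hasFDerivAt
  /- a basis vector `e` with `M e ≠ 0`, the other three `w i` -/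
  obtain ⟨j, hj⟩ : ∃ j : Fin 4, M (EuclideanSpace.single j (1 : ℝ)) ≠ 0 := by
    by_contra h
    push Not at h
    exact hne (clm_eq_zero_of_forall_apply_single_eq_zero h)
  set e : 𝔼 4 := EuclideanSpace.single j (1 : ℝ) with he
  set w : Fin 3 → 𝔼 4 := fun i => EuclideanSpace.single (j.succAbove i) (1 : ℝ) with hw
  have he0 : e ≠ 0 := by
    intro h
    apply hj
    rw [h, map_zero]
  /- covectors `ℓ₀` (cokernel) and `ℓ'` (`ℓ'(M e) = 1`) -/
  obtain ⟨ℓ₀, hℓ₀, hℓ₀M⟩ := exists_ne_zero_comp_eq_zero hcrit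
  have hℓ₀m : ℓ₀ (M e) = 0 := by
    simpa using congrArg (fun ψ : 𝔼 4 →L[ℝ] ℝ => ψ e) hℓ₀M
  obtain ⟨ℓ', hℓ'm⟩ := exists_covector_apply_eq_one hj
  /- the functions `N = ℓ₀(dg e)`, `Dn = ℓ'(dg e)`, `V₀ = ℓ₀ ∘ dg`, `V₁ = ℓ' ∘ dg`, `H` -/
  set N : 𝔼 4 → ℝ := fun q => ℓ₀ (fderiv ℝ g q e) with hN
  set Dn : 𝔼 4 → ℝ := fun q => ℓ' (fderiv ℝ g q e) with hDn
  set V₀ : 𝔼 4 → (𝔼 4 →L[ℝ] ℝ) := fun q => ℓ₀.comp (fderiv ℝ g q) with hV₀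
  set V₁ : 𝔼 4 → (𝔼 4 →L[ℝ] ℝ) := fun q => ℓ'.comp (fderiv ℝ g q) with hV₁
  set H : 𝔼 4 → (𝔼 4 →L[ℝ] ℝ) := fun q => Dn q • V₀ q - N q • V₁ q with hH
  have hHq : ∀ q, H q = ℓ' (fderiv ℝ g q e) • ℓ₀.comp (fderiv ℝ g q) -
      ℓ₀ (fderiv ℝ g q e) • ℓ'.comp (fderiv ℝ g q) := fun q => rfl
  have hHe : ∀ q, H q e = 0 := fun q => by
    rw [hHq]
    simp only [_root_.sub_apply, _root_.smul_apply, ContinuousLinearMap.comp_apply, smul_eq_mul]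
    ring
  /- smoothness on `Ω` -/
  have hev : ∀ u : 𝔼 4, ContDiffOn ℝ ∞ (fun q => fderiv ℝ g q u) Ω := fun u =>
    (ContinuousLinearMap.apply ℝ (𝔼 2) u).contDiff.comp_contDiffOn hdg
  have hNs : ContDiffOn ℝ ∞ N Ω := ℓ₀.contDiff.comp_contDiffOn (hev e)
  have hDns : ContDiffOn ℝ ∞ Dn Ω := ℓ'.contDiff.comp_contDiffOn (hev e)
  have hV₀s : ContDiffOn ℝ ∞ V₀ Ω :=
    (ContinuousLinearMap.compL ℝ (𝔼 4) (𝔼 2) ℝ ℓ₀).contDiff.comp_contDiffOn hdg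
  have hV₁s : ContDiffOn ℝ ∞ V₁ Ω :=
    (ContinuousLinearMap.compL ℝ (𝔼 4) (𝔼 2) ℝ ℓ').contDiff.comp_contDiffOn hdg
  have hHs : ContDiffOn ℝ ∞ H Ω := (hDns.smul hV₀s).sub (hNs.smul hV₁s)
  /- derivatives at `x₀` -/
  have hevd : HasFDerivAt (fun q => fderiv ℝ g q e)
      ((ContinuousLinearMap.apply ℝ (𝔼 2) e).comp D2) x₀ :=
    (ContinuousLinearMap.apply ℝ (𝔼 2) e).hasFDerivAt.comp x₀ hD2d
  set N' : 𝔼 4 →L[ℝ] ℝ := ℓ₀.comp ((ContinuousLinearMap.apply ℝ (𝔼 2) e).comp D2) with hN'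
  have hN'apply : ∀ v, N' v = ℓ₀ (D2 v e) := fun v => rfl
  have hNd : HasFDerivAt N N' x₀ := ℓ₀.hasFDerivAt.comp x₀ hevd
  have hDnd : HasFDerivAt Dn (ℓ'.comp ((ContinuousLinearMap.apply ℝ (𝔼 2) e).comp D2)) x₀ :=
    ℓ'.hasFDerivAt.comp x₀ hevd
  have hV₀d : HasFDerivAt V₀ ((ContinuousLinearMap.compL ℝ (𝔼 4) (𝔼 2) ℝ ℓ₀).comp D2) x₀ :=
    (ContinuousLinearMap.compL ℝ (𝔼 4) (𝔼 2) ℝ ℓ₀).hasFDerivAt.comp x₀ hD2d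
  have hV₁d : HasFDerivAt V₁ ((ContinuousLinearMap.compL ℝ (𝔼 4) (𝔼 2) ℝ ℓ').comp D2) x₀ :=
    (ContinuousLinearMap.compL ℝ (𝔼 4) (𝔼 2) ℝ ℓ').hasFDerivAt.comp x₀ hD2d
  have hN0 : N x₀ = 0 := hℓ₀m
  have hDn0 : Dn x₀ = 1 := hℓ'm
  have hV₀0 : V₀ x₀ = 0 := hℓ₀M
  -- the derivative `S = DH(x₀)`: `S v = ℓ₀ ∘ D²g(x₀) v - ℓ₀(D²g(x₀)(v, e)) · ℓ' ∘ M`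
  set S : 𝔼 4 →L[ℝ] (𝔼 4 →L[ℝ] ℝ) :=
    (ContinuousLinearMap.compL ℝ (𝔼 4) (𝔼 2) ℝ ℓ₀).comp D2 - N'.smulRight (ℓ'.comp M) with hS
  have hSv : ∀ v, S v = ℓ₀.comp (D2 v) - ℓ₀ (D2 v e) • ℓ'.comp M := fun v => rfl
  have hHd : HasFDerivAt H S x₀ := by
    have h := (hDnd.smul hV₀d).sub (hNd.smul hV₁d)
    refine h.congr_fderiv ?_
    ext v u
    rw [hSv]
    simp only [hN0, hDn0, hV₀0]
    simp [hV₁, hN'apply, hM]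
  /- `S v e = 0`; every covector killing `e` is a value of `S` (surjective incidence form) -/
  have hSe : ∀ v, S v e = 0 := fun v => by
    rw [hSv]
    simp [hℓ'm]
  have hSonto : ∀ ψ : 𝔼 4 →L[ℝ] ℝ, ψ e = 0 → ∃ v, S v = ψ := by
    intro ψ hψ
    obtain ⟨⟨v, lam⟩, hvl⟩ := htr.surjective_incidence hℓ₀ hℓ₀M ψ
    have hvl' : ℓ₀.comp (D2 v) + lam.comp M = ψ := hvl
    rw [comp_eq_smul_comp hcrit hℓ'm lam] at hvl'
    have hlam : lam (M e) = -ℓ₀ (D2 v e) := by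
      have h := congrArg (fun χ : 𝔼 4 →L[ℝ] ℝ => χ e) hvl'
      simp only [_root_.add_apply, ContinuousLinearMap.comp_apply, _root_.smul_apply, hℓ'm,
        smul_eq_mul, mul_one, hψ] at h
      linarith
    refine ⟨v, ?_⟩
    rw [← hvl']
    ext u
    simp only [hSv, _root_.sub_apply, _root_.add_apply, _root_.smul_apply,
      ContinuousLinearMap.comp_apply, smul_eq_mul, hlam]
    ring
  /- the kernel of `S` is a line `ℝ t₀`; `S v = 0` iff its three `w`-components vanish -/
  obtain ⟨t₀, ht₀0, hSt₀, hkerline⟩ := exists_ker_eq_line he0 hSe hSonto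
  have hSzero : ∀ v, (∀ i : Fin 3, S v (w i) = 0) → S v = 0 := fun v hv =>
    eq_zero_of_apply_single_succAbove j (hSe v) hv
  /- the covector `α` with `α t₀ = 1` and the differential `Φ'` of the chart -/
  obtain ⟨α, hα⟩ := exists_covector_apply_eq_one ht₀0
  set Φ' : 𝔼 4 →L[ℝ] 𝔼 4 :=
    α.smulRight (EuclideanSpace.single (0 : Fin 4) (1 : ℝ)) +
      ((ContinuousLinearMap.apply ℝ ℝ (w 0)).comp S).smulRight
        (EuclideanSpace.single (1 : Fin 4) (1 : ℝ)) +
      ((ContinuousLinearMap.apply ℝ ℝ (w 1)).comp S).smulRight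
        (EuclideanSpace.single (2 : Fin 4) (1 : ℝ)) +
      ((ContinuousLinearMap.apply ℝ ℝ (w 2)).comp S).smulRight
        (EuclideanSpace.single (3 : Fin 4) (1 : ℝ)) with hΦ'
  have hΦ'0 : ∀ v, Φ' v 0 = α v := fun v => by
    simp [hΦ']
  have hΦ'succ : ∀ v (i : Fin 3), Φ' v i.succ = S v (w i) := fun v i => by
    fin_cases i <;> simp [hΦ']
  have hΦ'inj : Injective Φ' := by
    refine (injective_iff_map_eq_zero Φ').2 fun v hv => ?_
    have hS0 : S v = 0 := hSzero v fun i => by rw [← hΦ'succ, hv]; rfl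
    obtain ⟨c, rfl⟩ := hkerline v hS0
    have : α (c • t₀) = 0 := by rw [← hΦ'0, hv]; rfl
    rw [map_smul, hα, smul_eq_mul, mul_one] at this
    rw [this, zero_smul]
  obtain ⟨T, hT⟩ := exists_continuousLinearEquiv_coe_eq hΦ'inj
  /- the chart map and its derivative -/
  set φf : 𝔼 4 → 𝔼 4 := fun q =>
    WithLp.toLp 2 ![α (q - x₀), H q (w 0), H q (w 1), H q (w 2)] with hφf
  have hφf0 : ∀ q, φf q 0 = α (q - x₀) := fun q => by simp [hφf]
  have hφfsucc : ∀ q (i : Fin 3), φf q i.succ = H q (w i) := fun q i => by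
    fin_cases i <;> simp [hφf]
  have hφf0' : (fun q => φf q 0) = fun q => α (q - x₀) := funext hφf0
  have hφfsucc' : ∀ i : Fin 3, (fun q => φf q i.succ) = fun q => H q (w i) := fun i =>
    funext fun q => hφfsucc q i
  have hHw : ∀ i : Fin 3, ContDiffOn ℝ ∞ (fun q => H q (w i)) Ω := fun i =>
    (ContinuousLinearMap.apply ℝ ℝ (w i)).contDiff.comp_contDiffOn hHs
  have hφfs : ContDiffOn ℝ ∞ φf Ω := by
    rw [contDiffOn_euclidean]
    intro i
    refine Fin.cases ?_ (fun i => ?_) i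
    · rw [hφf0']
      exact (α.contDiff.comp (contDiff_id.sub contDiff_const)).contDiffOn
    · rw [hφfsucc' i]
      exact hHw i
  have hHwd : ∀ i : Fin 3, HasFDerivAt (fun q => H q (w i))
      ((ContinuousLinearMap.apply ℝ ℝ (w i)).comp S) x₀ := fun i =>
    (ContinuousLinearMap.apply ℝ ℝ (w i)).hasFDerivAt.comp x₀ hHd
  have hαd : HasFDerivAt (fun q : 𝔼 4 => α (q - x₀)) α x₀ := by
    have h := α.hasFDerivAt.comp x₀ ((hasFDerivAt_id x₀).sub_const x₀)
    rw [ContinuousLinearMap.comp_id] at h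
    exact h
  have hφfd : HasFDerivAt φf Φ' x₀ := by
    rw [← hasFDerivWithinAt_univ]
    refine hasFDerivWithinAt_euclidean.2 fun i => ?_
    refine Fin.cases ?_ (fun i => ?_) i
    · rw [hφf0']
      refine (hαd.hasFDerivWithinAt (s := univ)).congr_fderiv ?_
      ext v
      simp [hΦ'0]
    · rw [hφfsucc' i]
      refine ((hHwd i).hasFDerivWithinAt (s := univ)).congr_fderiv ?_
      ext v
      simp [hΦ'succ]
  /- the open set where `dg_q e ≠ 0`, and the inverse function theorem -/
  set O : Set (𝔼 4) := Ω ∩ (fun q => fderiv ℝ g q e) ⁻¹' {u | u ≠ 0} with hO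
  have hOo : IsOpen O := (hev e).continuousOn.isOpen_inter_preimage hΩ isOpen_ne
  have hx₀O : x₀ ∈ O := ⟨hx₀, hj⟩
  have hOΩ : O ⊆ Ω := inter_subset_left
  obtain ⟨G, hGφ, hxG, hGO, hGs, hGs'⟩ :=
    exists_openPartialHomeomorph_contDiffOn_symm hOo hx₀O (m := ∞) (by simp) (hφfs.mono hOΩ) T
      (by rw [hT]; exact hφfd)
  /- `H q = 0` iff its three `w`-components vanish -/
  have hHzero : ∀ q, (H q = 0 ↔ ∀ i : Fin 3, H q (w i) = 0) := fun q =>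
    ⟨fun h i => by rw [h]; rfl, fun h => eq_zero_of_apply_single_succAbove j (hHe q) h⟩
  /- assemble -/
  refine ⟨G, hxG, ?_, hGO.trans hOΩ, hGs, hGs', ?_, ?_⟩
  · -- `φ x₀ = 0`
    have hH0 : H x₀ = 0 := by
      change Dn x₀ • V₀ x₀ - N x₀ • V₁ x₀ = 0
      rw [hN0, hV₀0, smul_zero, zero_smul, sub_zero]
    rw [hGφ]
    ext i
    refine Fin.cases ?_ (fun i => ?_) i
    · rw [hφf0, sub_self, map_zero]
      rfl
    · rw [hφfsucc, hH0]
      rfl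
  · -- criticality iff the last three coordinates vanish
    intro q hq
    have hqO : q ∈ O := hGO hq
    rw [not_surjective_iff_smul_comp_sub_eq_zero hℓ₀ hℓ₀m hℓ'm (Mq := fderiv ℝ g q) hqO.2,
      ← hHq, hHzero q]
    refine forall_congr' fun i => ?_
    rw [hGφ, hφfsucc]
  · -- the tangent line
    intro ℓ hℓ hℓM v
    have hfd : fderiv ℝ G x₀ = Φ' := by rw [hGφ]; exact hφfd.fderiv
    -- `ℓ = a ℓ₀` with `a ≠ 0`
    have hℓm : ℓ (M e) = 0 := by simpa using congrArg (fun ψ : 𝔼 4 →L[ℝ] ℝ => ψ e) hℓM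
    obtain ⟨a, rfl⟩ := exists_eq_smul_covector hℓ₀ hℓ₀m hj hℓm
    have ha : a ≠ 0 := by
      rintro rfl
      exact hℓ (zero_smul _ _)
    have hscale : (∀ k, M k = 0 → (a • ℓ₀) (D2 v k) = 0) ↔ ∀ k, M k = 0 → ℓ₀ (D2 v k) = 0 := by
      refine forall_congr' fun k => imp_congr_right fun _ => ?_
      rw [_root_.smul_apply, smul_eq_mul, mul_eq_zero, or_iff_right ha]
    rw [hscale, forall_ker_iff_comp_sub_smul_eq_zero hcrit hj hℓ'm (D := D2 v), ← hSv, hfd]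
    constructor
    · intro h i
      rw [hΦ'succ, h]
      rfl
    · intro h
      exact hSzero v fun i => by rw [← hΦ'succ]; exact h i

end Chart

end OneJet

end Literature.Topology.FourManifolds
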